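import Summits.Ventures.CertifiedManyBodySolver.Observables.StiffnessApexTransportCurtain
import Summits.Ventures.CertifiedManyBodySolver.Observables.StiffnessApexTransportLaBoxE
import HarnessLib

/-!
# Ventures/CertifiedManyBodySolver — Observables/StiffnessApexTransportCurtainLadderLaBoxE.lean

HONEST FRAMING: one-sided certified CEILINGS on the uniform flux stiffness (`t–t′` f-sum class) at half filling, transported into the «La214-E» box
`[−3/10, −1/5] × [29/5, 74/5]` (`n = 1`) from THREE stations each read with a SHORT corner-objective overhang; a ceiling never speaks to the presence of
order; not a `T_c` estimate, not a superconductivity verdict; every leaf is CONDITIONAL on the row families it names. Zero compute, no definition, no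
claim node, no `sorry`.

Cell `pub/hubbard-downfold` (D-0154 (1)(C) COVERAGE, La214 M2(b) depth), seat `hubbard-cov-la214-unc-2` (`prover-hubbard-cov-la214-unc-2-0`). The «La214-E»
literal instance of the corner-objective LADDER (`Observables/StiffnessApexTransportCurtainLadder.lean`, seat hubbard-downfold-unc-2 g15, generic `U : ℕ → ℝ`)
at the THREE STATIONS OF RECORD `29/5, 8, 11` (director-hubbard R19 fallback «three stations with overhang only to ≈ −0.383»; obs RULING (ggg) d303 (ggg2) case (2);
the parents pre-registered by `hubbard-cov-la214-gen-1` W1a–e and the solves claimed by `hubbard-cov-la214-sdp-1` for that case): station `U_k` carries its INNER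
own words on `[−3/10, −1/5] × {U_k}` and corner-objective (`−X₀(−3/10)`) words on the SHORT overhang `[(−3/10)(2 − U_k/U_{k+1}), −3/10] × {U_k}` —
`[−153/400, −3/10] × {29/5}`, `[−21/55, −3/10] × {8}`, `[−279/740, −3/10] × {11}` (`laBoxE_three_apexStations_overhangs`) — versus the companion
`ObsStiffnessSeqCeilingAt_on_laBoxE_of_three_apexStations_orbitLower` (seat hubbard-downfold-unc-2 g13), where every station is read with its OWN words on the
whole segment down to the overhang end (kinematic scale up to `k(−0.383) ≈ 0.466` [float] instead of `k(−3/10) = 0.4392` at every overhang source).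

* `ObsStiffnessSeqCeilingAt_on_laBoxE_of_threeStations_inner_and_cornerObjectiveOverhang` — family form (six families);
* `ObsStiffnessSeqCeilingAt_on_laBoxE_of_threeStations_sixChords` — what SIX two-vertex bundles deliver (three inner chords, three overhang chords; twelve
  vertex constants at nine distinct points — the `(U_k; −3/10)` own-word certificate serves the inner AND the overhang chord of its station); `c ≥` each of
  the twelve negated constants.

References: T. Koma, H. Tasaki, J. Stat. Phys. 76 (1994) 745, §1 [KomaTasaki1994]; D. J. Scalapino, S. R. White, S.-C. Zhang, PRB 47 (1993)
7995, §II [ScalapinoWhiteZhang1993].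
-/

noncomputable section

namespace Summit.Ventures.CertifiedManyBodySolver.Observables

open Literature.MathematicalPhysics.QuantumLattice
open Literature.MathematicalPhysics.QuantumLattice.ThermodynamicLimit
open Literature.MathematicalPhysics.QuantumFieldTheory
open Literature.Probability.LatticeModels
open Matrix Finset Filter Topology HubbardWave0
open scoped Matrix BigOperators ComplexOrder

section LaBoxE

/-- **«La214-E» FROM THREE STATIONS `29/5, 8, 11`, each with a SHORT CORNER-OBJECTIVE OVERHANG (family form).** For `k = 1, 2, 3` (stations `29/5, 8, 11`,
slab tops `8, 11, 74/5`): an own-word orbit-lower family `valIₖ` on the inner segment `[−3/10, −1/5] × {U_k}` and an orbit-lower family `valOₖ` for the FIXED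
corner objective `−X₀(−3/10)` on the overhang `[−153/400 | −21/55 | −279/740, −3/10] × {U_k}` (half filling), all with `−val ≤ c`. Then
`ObsStiffnessSeqCeilingAt t′ U 1 c` on the whole box `[−3/10, −1/5] × [29/5, 74/5]`: (E1) on each slab `[29/5, 8]`, `[8, 11]`, `[11, 74/5]`.
[cite: KomaTasaki1994, §1] [cite: ScalapinoWhiteZhang1993, §II] -/
theorem ObsStiffnessSeqCeilingAt_on_laBoxE_of_threeStations_inner_and_cornerObjectiveOverhang
    (valI₁ valO₁ valI₂ valO₂ valI₃ valO₃ : ℝ → ℝ) (c : ℚ)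
    (hI₁ : ∀ s ∈ Set.Icc (-3 / 10 : ℝ) (-1 / 5),
      ∀ (ω : InfVolFermionState 2) (Ls : ℕ → ℕ) (ψ : ∀ L, Fock (Orb (FermionTorus 2 L))),
      Tendsto Ls atTop atTop →
      (∀ j, IsGroundStateInSector (hubbardTorusTT' (Ls j) 1 s (29 / 5)) (rectN 1 (Ls j)) 0 (ψ (Ls j))) →
      (∀ j, star (ψ (Ls j)) ⬝ᵥ ψ (Ls j) = 1) → ω.IsTorusLimitOf ψ Ls →
      valI₁ s ≤ ((Finset.univ : Finset (DihedralGroup 4)).card : ℝ)⁻¹ * ∑ g ∈ (Finset.univ : Finset (DihedralGroup 4)),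
        (ω.expect (d4ShiftSet g 0 (box 2 7)) (fermionEmbed (PolySite.d4Emb g 0 (box 2 7)) (-oddMomentObsTT s (29 / 5) 0))).re)
    (hcI₁ : ∀ s ∈ Set.Icc (-3 / 10 : ℝ) (-1 / 5), -valI₁ s ≤ ((c : ℚ) : ℝ))
    (hO₁ : ∀ s ∈ Set.Icc (-(153 / 400) : ℝ) (-3 / 10),
      ∀ (ω : InfVolFermionState 2) (Ls : ℕ → ℕ) (ψ : ∀ L, Fock (Orb (FermionTorus 2 L))),
      Tendsto Ls atTop atTop →
      (∀ j, IsGroundStateInSector (hubbardTorusTT' (Ls j) 1 s (29 / 5)) (rectN 1 (Ls j)) 0 (ψ (Ls j))) →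
      (∀ j, star (ψ (Ls j)) ⬝ᵥ ψ (Ls j) = 1) → ω.IsTorusLimitOf ψ Ls →
      valO₁ s ≤ ((Finset.univ : Finset (DihedralGroup 4)).card : ℝ)⁻¹ * ∑ g ∈ (Finset.univ : Finset (DihedralGroup 4)),
        (ω.expect (d4ShiftSet g 0 (box 2 7)) (fermionEmbed (PolySite.d4Emb g 0 (box 2 7)) (-oddMomentObsTT (-3 / 10) (29 / 5) 0))).re)
    (hcO₁ : ∀ s ∈ Set.Icc (-(153 / 400) : ℝ) (-3 / 10), -valO₁ s ≤ ((c : ℚ) : ℝ))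
    (hI₂ : ∀ s ∈ Set.Icc (-3 / 10 : ℝ) (-1 / 5),
      ∀ (ω : InfVolFermionState 2) (Ls : ℕ → ℕ) (ψ : ∀ L, Fock (Orb (FermionTorus 2 L))),
      Tendsto Ls atTop atTop →
      (∀ j, IsGroundStateInSector (hubbardTorusTT' (Ls j) 1 s 8) (rectN 1 (Ls j)) 0 (ψ (Ls j))) →
      (∀ j, star (ψ (Ls j)) ⬝ᵥ ψ (Ls j) = 1) → ω.IsTorusLimitOf ψ Ls →
      valI₂ s ≤ ((Finset.univ : Finset (DihedralGroup 4)).card : ℝ)⁻¹ * ∑ g ∈ (Finset.univ : Finset (DihedralGroup 4)),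
        (ω.expect (d4ShiftSet g 0 (box 2 7)) (fermionEmbed (PolySite.d4Emb g 0 (box 2 7)) (-oddMomentObsTT s 8 0))).re)
    (hcI₂ : ∀ s ∈ Set.Icc (-3 / 10 : ℝ) (-1 / 5), -valI₂ s ≤ ((c : ℚ) : ℝ))
    (hO₂ : ∀ s ∈ Set.Icc (-(21 / 55) : ℝ) (-3 / 10),
      ∀ (ω : InfVolFermionState 2) (Ls : ℕ → ℕ) (ψ : ∀ L, Fock (Orb (FermionTorus 2 L))),
      Tendsto Ls atTop atTop →
      (∀ j, IsGroundStateInSector (hubbardTorusTT' (Ls j) 1 s 8) (rectN 1 (Ls j)) 0 (ψ (Ls j))) →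
      (∀ j, star (ψ (Ls j)) ⬝ᵥ ψ (Ls j) = 1) → ω.IsTorusLimitOf ψ Ls →
      valO₂ s ≤ ((Finset.univ : Finset (DihedralGroup 4)).card : ℝ)⁻¹ * ∑ g ∈ (Finset.univ : Finset (DihedralGroup 4)),
        (ω.expect (d4ShiftSet g 0 (box 2 7)) (fermionEmbed (PolySite.d4Emb g 0 (box 2 7)) (-oddMomentObsTT (-3 / 10) 8 0))).re)
    (hcO₂ : ∀ s ∈ Set.Icc (-(21 / 55) : ℝ) (-3 / 10), -valO₂ s ≤ ((c : ℚ) : ℝ))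
    (hI₃ : ∀ s ∈ Set.Icc (-3 / 10 : ℝ) (-1 / 5),
      ∀ (ω : InfVolFermionState 2) (Ls : ℕ → ℕ) (ψ : ∀ L, Fock (Orb (FermionTorus 2 L))),
      Tendsto Ls atTop atTop →
      (∀ j, IsGroundStateInSector (hubbardTorusTT' (Ls j) 1 s 11) (rectN 1 (Ls j)) 0 (ψ (Ls j))) →
      (∀ j, star (ψ (Ls j)) ⬝ᵥ ψ (Ls j) = 1) → ω.IsTorusLimitOf ψ Ls →
      valI₃ s ≤ ((Finset.univ : Finset (DihedralGroup 4)).card : ℝ)⁻¹ * ∑ g ∈ (Finset.univ : Finset (DihedralGroup 4)),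
        (ω.expect (d4ShiftSet g 0 (box 2 7)) (fermionEmbed (PolySite.d4Emb g 0 (box 2 7)) (-oddMomentObsTT s 11 0))).re)
    (hcI₃ : ∀ s ∈ Set.Icc (-3 / 10 : ℝ) (-1 / 5), -valI₃ s ≤ ((c : ℚ) : ℝ))
    (hO₃ : ∀ s ∈ Set.Icc (-(279 / 740) : ℝ) (-3 / 10),
      ∀ (ω : InfVolFermionState 2) (Ls : ℕ → ℕ) (ψ : ∀ L, Fock (Orb (FermionTorus 2 L))),
      Tendsto Ls atTop atTop →
      (∀ j, IsGroundStateInSector (hubbardTorusTT' (Ls j) 1 s 11) (rectN 1 (Ls j)) 0 (ψ (Ls j))) →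
      (∀ j, star (ψ (Ls j)) ⬝ᵥ ψ (Ls j) = 1) → ω.IsTorusLimitOf ψ Ls →
      valO₃ s ≤ ((Finset.univ : Finset (DihedralGroup 4)).card : ℝ)⁻¹ * ∑ g ∈ (Finset.univ : Finset (DihedralGroup 4)),
        (ω.expect (d4ShiftSet g 0 (box 2 7)) (fermionEmbed (PolySite.d4Emb g 0 (box 2 7)) (-oddMomentObsTT (-3 / 10) 11 0))).re)
    (hcO₃ : ∀ s ∈ Set.Icc (-(279 / 740) : ℝ) (-3 / 10), -valO₃ s ≤ ((c : ℚ) : ℝ)) :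
    ∀ tp ∈ Set.Icc (-3 / 10 : ℝ) (-1 / 5), ∀ U ∈ Set.Icc (29 / 5 : ℝ) (74 / 5), ObsStiffnessSeqCeilingAt tp U 1 c := by
  obtain ⟨e₁, e₂, e₃⟩ := laBoxE_three_apexStations_overhangs
  intro tp htp U hU
  rcases le_total U 8 with hU8 | hU8
  · exact ObsStiffnessSeqCeilingAt_halfFilling_on_box_of_apexStation_inner_and_cornerObjectiveOverhang (UA := 29 / 5) (Umax := 8)
      (p := -3 / 10) (q := -1 / 5) (by norm_num) (by norm_num) (by norm_num) (by norm_num) valI₁ valO₁ c hI₁ hcI₁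
      (fun s hs => hO₁ s (by rwa [e₁] at hs)) (fun s hs => hcO₁ s (by rwa [e₁] at hs)) tp htp U ⟨hU.1, hU8⟩
  rcases le_total U 11 with hU11 | hU11
  · exact ObsStiffnessSeqCeilingAt_halfFilling_on_box_of_apexStation_inner_and_cornerObjectiveOverhang (UA := 8) (Umax := 11)
      (p := -3 / 10) (q := -1 / 5) (by norm_num) (by norm_num) (by norm_num) (by norm_num) valI₂ valO₂ c hI₂ hcI₂
      (fun s hs => hO₂ s (by rwa [e₂] at hs)) (fun s hs => hcO₂ s (by rwa [e₂] at hs)) tp htp U ⟨hU8, hU11⟩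
  · exact ObsStiffnessSeqCeilingAt_halfFilling_on_box_of_apexStation_inner_and_cornerObjectiveOverhang (UA := 11) (Umax := 74 / 5)
      (p := -3 / 10) (q := -1 / 5) (by norm_num) (by norm_num) (by norm_num) (by norm_num) valI₃ valO₃ c hI₃ hcI₃
      (fun s hs => hO₃ s (by rwa [e₃] at hs)) (fun s hs => hcO₃ s (by rwa [e₃] at hs)) tp htp U ⟨hU11, hU.2⟩

/-- An affine chord of two constants on `[a, b]`, each at least `−c`, is at least `−c` at every point of the segment. [folklore] -/
theorem neg_chord_le_of_ends {a b s v₁ v₂ : ℝ} {c : ℚ} (hab : a < b) (hs : s ∈ Set.Icc a b) (h₁ : -v₁ ≤ ((c : ℚ) : ℝ))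
    (h₂ : -v₂ ≤ ((c : ℚ) : ℝ)) : -((b - s) / (b - a) * v₁ + (s - a) / (b - a) * v₂) ≤ ((c : ℚ) : ℝ) := by
  obtain ⟨hl₁, hl₂, hsum, -, -⟩ := tPrimeSegment_weights hab hs.1 hs.2
  have hmin := min_le_chord_of_weights (c₁ := v₁) (c₂ := v₂) hl₁ hl₂ hsum
  have hneg : -min v₁ v₂ ≤ ((c : ℚ) : ℝ) := by
    rcases le_total v₁ v₂ with hv | hv
    · rw [min_eq_left hv]; exact h₁
    · rw [min_eq_right hv]; exact h₂
  linarith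

/-- **«La214-E» FROM THREE STATIONS, SIX BUNDLES, twelve vertex constants.** At each station `U_k ∈ {29/5, 8, 11}`: the INNER bundle = the chord of the
own-word constants `vIₖa` (at `−3/10`) and `vIₖb` (at `−1/5`) on `[−3/10, −1/5] × {U_k}`; the OVERHANG bundle = the chord of `vOₖa` (at the overhang end
`−153/400 | −21/55 | −279/740`) and `vOₖb` (at `−3/10`) for the CONSTANT objective `−X₀(−3/10)` (the `(U_k; −3/10)` own-word certificate IS the `vOₖb`
certificate); `c ≥` each of the twelve negated constants. Then `ObsStiffnessSeqCeilingAt t′ U 1 c` on the whole box `[−3/10, −1/5] × [29/5, 74/5]`.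
[cite: KomaTasaki1994, §1] [cite: ScalapinoWhiteZhang1993, §II] -/
theorem ObsStiffnessSeqCeilingAt_on_laBoxE_of_threeStations_sixChords
    (vI₁a vI₁b vO₁a vO₁b vI₂a vI₂b vO₂a vO₂b vI₃a vI₃b vO₃a vO₃b : ℝ) (c : ℚ)
    (hcI₁a : -vI₁a ≤ ((c : ℚ) : ℝ)) (hcI₁b : -vI₁b ≤ ((c : ℚ) : ℝ)) (hcO₁a : -vO₁a ≤ ((c : ℚ) : ℝ)) (hcO₁b : -vO₁b ≤ ((c : ℚ) : ℝ))
    (hcI₂a : -vI₂a ≤ ((c : ℚ) : ℝ)) (hcI₂b : -vI₂b ≤ ((c : ℚ) : ℝ)) (hcO₂a : -vO₂a ≤ ((c : ℚ) : ℝ)) (hcO₂b : -vO₂b ≤ ((c : ℚ) : ℝ))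
    (hcI₃a : -vI₃a ≤ ((c : ℚ) : ℝ)) (hcI₃b : -vI₃b ≤ ((c : ℚ) : ℝ)) (hcO₃a : -vO₃a ≤ ((c : ℚ) : ℝ)) (hcO₃b : -vO₃b ≤ ((c : ℚ) : ℝ))
    (hI₁ : ∀ s ∈ Set.Icc (-3 / 10 : ℝ) (-1 / 5),
      ∀ (ω : InfVolFermionState 2) (Ls : ℕ → ℕ) (ψ : ∀ L, Fock (Orb (FermionTorus 2 L))),
      Tendsto Ls atTop atTop →
      (∀ j, IsGroundStateInSector (hubbardTorusTT' (Ls j) 1 s (29 / 5)) (rectN 1 (Ls j)) 0 (ψ (Ls j))) →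
      (∀ j, star (ψ (Ls j)) ⬝ᵥ ψ (Ls j) = 1) → ω.IsTorusLimitOf ψ Ls →
      (-1 / 5 - s) / (-1 / 5 - -3 / 10) * vI₁a + (s - -3 / 10) / (-1 / 5 - -3 / 10) * vI₁b ≤ ((Finset.univ : Finset (DihedralGroup 4)).card : ℝ)⁻¹ * ∑ g ∈ (Finset.univ : Finset (DihedralGroup 4)),
        (ω.expect (d4ShiftSet g 0 (box 2 7)) (fermionEmbed (PolySite.d4Emb g 0 (box 2 7)) (-oddMomentObsTT s (29 / 5) 0))).re)
    (hO₁ : ∀ s ∈ Set.Icc (-(153 / 400) : ℝ) (-3 / 10),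
      ∀ (ω : InfVolFermionState 2) (Ls : ℕ → ℕ) (ψ : ∀ L, Fock (Orb (FermionTorus 2 L))),
      Tendsto Ls atTop atTop →
      (∀ j, IsGroundStateInSector (hubbardTorusTT' (Ls j) 1 s (29 / 5)) (rectN 1 (Ls j)) 0 (ψ (Ls j))) →
      (∀ j, star (ψ (Ls j)) ⬝ᵥ ψ (Ls j) = 1) → ω.IsTorusLimitOf ψ Ls →
      (-3 / 10 - s) / (-3 / 10 - -(153 / 400)) * vO₁a + (s - -(153 / 400)) / (-3 / 10 - -(153 / 400)) * vO₁b ≤ ((Finset.univ : Finset (DihedralGroup 4)).card : ℝ)⁻¹ * ∑ g ∈ (Finset.univ : Finset (DihedralGroup 4)),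
        (ω.expect (d4ShiftSet g 0 (box 2 7)) (fermionEmbed (PolySite.d4Emb g 0 (box 2 7)) (-oddMomentObsTT (-3 / 10) (29 / 5) 0))).re)
    (hI₂ : ∀ s ∈ Set.Icc (-3 / 10 : ℝ) (-1 / 5),
      ∀ (ω : InfVolFermionState 2) (Ls : ℕ → ℕ) (ψ : ∀ L, Fock (Orb (FermionTorus 2 L))),
      Tendsto Ls atTop atTop →
      (∀ j, IsGroundStateInSector (hubbardTorusTT' (Ls j) 1 s 8) (rectN 1 (Ls j)) 0 (ψ (Ls j))) →
      (∀ j, star (ψ (Ls j)) ⬝ᵥ ψ (Ls j) = 1) → ω.IsTorusLimitOf ψ Ls →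
      (-1 / 5 - s) / (-1 / 5 - -3 / 10) * vI₂a + (s - -3 / 10) / (-1 / 5 - -3 / 10) * vI₂b ≤ ((Finset.univ : Finset (DihedralGroup 4)).card : ℝ)⁻¹ * ∑ g ∈ (Finset.univ : Finset (DihedralGroup 4)),
        (ω.expect (d4ShiftSet g 0 (box 2 7)) (fermionEmbed (PolySite.d4Emb g 0 (box 2 7)) (-oddMomentObsTT s 8 0))).re)
    (hO₂ : ∀ s ∈ Set.Icc (-(21 / 55) : ℝ) (-3 / 10),
      ∀ (ω : InfVolFermionState 2) (Ls : ℕ → ℕ) (ψ : ∀ L, Fock (Orb (FermionTorus 2 L))),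
      Tendsto Ls atTop atTop →
      (∀ j, IsGroundStateInSector (hubbardTorusTT' (Ls j) 1 s 8) (rectN 1 (Ls j)) 0 (ψ (Ls j))) →
      (∀ j, star (ψ (Ls j)) ⬝ᵥ ψ (Ls j) = 1) → ω.IsTorusLimitOf ψ Ls →
      (-3 / 10 - s) / (-3 / 10 - -(21 / 55)) * vO₂a + (s - -(21 / 55)) / (-3 / 10 - -(21 / 55)) * vO₂b ≤ ((Finset.univ : Finset (DihedralGroup 4)).card : ℝ)⁻¹ * ∑ g ∈ (Finset.univ : Finset (DihedralGroup 4)),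
        (ω.expect (d4ShiftSet g 0 (box 2 7)) (fermionEmbed (PolySite.d4Emb g 0 (box 2 7)) (-oddMomentObsTT (-3 / 10) 8 0))).re)
    (hI₃ : ∀ s ∈ Set.Icc (-3 / 10 : ℝ) (-1 / 5),
      ∀ (ω : InfVolFermionState 2) (Ls : ℕ → ℕ) (ψ : ∀ L, Fock (Orb (FermionTorus 2 L))),
      Tendsto Ls atTop atTop →
      (∀ j, IsGroundStateInSector (hubbardTorusTT' (Ls j) 1 s 11) (rectN 1 (Ls j)) 0 (ψ (Ls j))) →
      (∀ j, star (ψ (Ls j)) ⬝ᵥ ψ (Ls j) = 1) → ω.IsTorusLimitOf ψ Ls →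
      (-1 / 5 - s) / (-1 / 5 - -3 / 10) * vI₃a + (s - -3 / 10) / (-1 / 5 - -3 / 10) * vI₃b ≤ ((Finset.univ : Finset (DihedralGroup 4)).card : ℝ)⁻¹ * ∑ g ∈ (Finset.univ : Finset (DihedralGroup 4)),
        (ω.expect (d4ShiftSet g 0 (box 2 7)) (fermionEmbed (PolySite.d4Emb g 0 (box 2 7)) (-oddMomentObsTT s 11 0))).re)
    (hO₃ : ∀ s ∈ Set.Icc (-(279 / 740) : ℝ) (-3 / 10),
      ∀ (ω : InfVolFermionState 2) (Ls : ℕ → ℕ) (ψ : ∀ L, Fock (Orb (FermionTorus 2 L))),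
      Tendsto Ls atTop atTop →
      (∀ j, IsGroundStateInSector (hubbardTorusTT' (Ls j) 1 s 11) (rectN 1 (Ls j)) 0 (ψ (Ls j))) →
      (∀ j, star (ψ (Ls j)) ⬝ᵥ ψ (Ls j) = 1) → ω.IsTorusLimitOf ψ Ls →
      (-3 / 10 - s) / (-3 / 10 - -(279 / 740)) * vO₃a + (s - -(279 / 740)) / (-3 / 10 - -(279 / 740)) * vO₃b ≤ ((Finset.univ : Finset (DihedralGroup 4)).card : ℝ)⁻¹ * ∑ g ∈ (Finset.univ : Finset (DihedralGroup 4)),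
        (ω.expect (d4ShiftSet g 0 (box 2 7)) (fermionEmbed (PolySite.d4Emb g 0 (box 2 7)) (-oddMomentObsTT (-3 / 10) 11 0))).re) :
    ∀ tp ∈ Set.Icc (-3 / 10 : ℝ) (-1 / 5), ∀ U ∈ Set.Icc (29 / 5 : ℝ) (74 / 5), ObsStiffnessSeqCeilingAt tp U 1 c :=
  ObsStiffnessSeqCeilingAt_on_laBoxE_of_threeStations_inner_and_cornerObjectiveOverhang
    (fun s => (-1 / 5 - s) / (-1 / 5 - -3 / 10) * vI₁a + (s - -3 / 10) / (-1 / 5 - -3 / 10) * vI₁b)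
    (fun s => (-3 / 10 - s) / (-3 / 10 - -(153 / 400)) * vO₁a + (s - -(153 / 400)) / (-3 / 10 - -(153 / 400)) * vO₁b)
    (fun s => (-1 / 5 - s) / (-1 / 5 - -3 / 10) * vI₂a + (s - -3 / 10) / (-1 / 5 - -3 / 10) * vI₂b)
    (fun s => (-3 / 10 - s) / (-3 / 10 - -(21 / 55)) * vO₂a + (s - -(21 / 55)) / (-3 / 10 - -(21 / 55)) * vO₂b)
    (fun s => (-1 / 5 - s) / (-1 / 5 - -3 / 10) * vI₃a + (s - -3 / 10) / (-1 / 5 - -3 / 10) * vI₃b)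
    (fun s => (-3 / 10 - s) / (-3 / 10 - -(279 / 740)) * vO₃a + (s - -(279 / 740)) / (-3 / 10 - -(279 / 740)) * vO₃b) c
    hI₁ (fun s hs => neg_chord_le_of_ends (by norm_num) hs hcI₁a hcI₁b) hO₁ (fun s hs => neg_chord_le_of_ends (by norm_num) hs hcO₁a hcO₁b)
    hI₂ (fun s hs => neg_chord_le_of_ends (by norm_num) hs hcI₂a hcI₂b) hO₂ (fun s hs => neg_chord_le_of_ends (by norm_num) hs hcO₂a hcO₂b)
    hI₃ (fun s hs => neg_chord_le_of_ends (by norm_num) hs hcI₃a hcI₃b) hO₃ (fun s hs => neg_chord_le_of_ends (by norm_num) hs hcO₃a hcO₃b)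

end LaBoxE

end Summit.Ventures.CertifiedManyBodySolver.Observables

end
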